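import Summits.KontsevichZagierPeriods.KontsevichZagierPeriods.Theorems.SoloBlindMZVBox
import Summits.KontsevichZagierPeriods.KontsevichZagierPeriods.Theorems.SoloBlindZetaTwoSquare
import Literature.NumberTheory.Transcendental.PeriodsWave0Proofs
import Literature.NumberTheory.Transcendental.LindemannWeierstrassProofs
import HarnessLib

/-!
# `ℚ`-linear sectors: the Kontsevich–Zagier conjecture on the `ζ(n)`-lines

All sectors of `Q = FormalRep/relations` on which we have so far decided the Kontsevich–Zagier
conjecture were powered by a **transcendence** theorem (`π`, `log μ`, Lindemann–Weierstrass).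
Here is the cheapest mechanism, powered by mere **irrationality** — hence applicable to `ζ(3)`.

For a finite family `g : ι → Q` let the *linear sector* `L(g) ⊆ FormalRep` consist of the formal
combinations whose class is a `ℚ`-combination `Σ cᵢ gᵢ` (`linSector`; it contains `relations`).
If the real numbers `evalQ gᵢ` are `ℚ`-linearly independent then `eval` is injective on the
classes of `L(g)` (`linSector_kernel`), so **any two representations in `L(g)` with equal values
are KZ-equivalent** (`kz_linSector`).

The `ζ(n)`-line is `L(1, [B_n])`, `B_n = [(0,1)ⁿ, 1/(1-x₀⋯x_{n-1})]` Beukers' box.  It contains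
the rational constants, `B_n`, the simplex `Λ_n`, the box and simplex representations of
`ζ(2,1,…,1) (= ζ(n))`, and everything KZ-equivalent to a rational multiple of these.  The
conjecture holds on the `ζ(n)`-line as soon as `ζ(n) ∉ ℚ` (`kz_zetaLine`):

* **`n = 3` unconditionally, by Apéry's theorem** (`kz_zetaLine_three`);
* every even `n`, by `ζ(2k) ∈ ℚ^×·π^{2k}` and Lindemann (`kz_zetaLine_even`);
* **infinitely many odd `n`, by Ball–Rivoal** (`infinite_setOf_kzOnZetaLine_odd`) — an existence
  statement about sectors, with no explicit `n > 3` known.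
-/

noncomputable section

namespace Summit.KontsevichZagierPeriods.KontsevichZagierPeriods.Theorems

open Set MeasureTheory
open Literature.NumberTheory.Transcendental
open Literature.NumberTheory.Transcendental.KZ

namespace SoloBlind

variable {ι : Type} [Fintype ι]

/-! ## Linear sectors -/

/-- The `ℚ`-linear sector of a finite family of classes `g : ι → Q`: the formal combinations
whose class is `Σ cᵢ • gᵢ` with `cᵢ ∈ ℚ`. -/
def linSector (g : ι → Q) : AddSubgroup FormalRep where
  carrier := {z | ∃ c : ι → ℚ, mkQ z = ∑ i, ((c i : ℚ) : K₀) • g i}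
  zero_mem' := ⟨0, by simp⟩
  add_mem' := by
    rintro a b ⟨c, hc⟩ ⟨d, hd⟩
    refine ⟨c + d, ?_⟩
    rw [map_add, hc, hd, ← Finset.sum_add_distrib]
    refine Finset.sum_congr rfl fun i _ => ?_
    rw [Pi.add_apply, Rat.cast_add, add_smul]
  neg_mem' := by
    rintro a ⟨c, hc⟩
    refine ⟨-c, ?_⟩
    rw [map_neg, hc, ← Finset.sum_neg_distrib]
    refine Finset.sum_congr rfl fun i _ => ?_
    rw [Pi.neg_apply, Rat.cast_neg, neg_smul]

/-- Membership in a linear sector. -/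
theorem mem_linSector {g : ι → Q} {z : FormalRep} :
    z ∈ linSector g ↔ ∃ c : ι → ℚ, mkQ z = ∑ i, ((c i : ℚ) : K₀) • g i := Iff.rfl

/-- Every relation lies in every linear sector. -/
theorem relations_le_linSector (g : ι → Q) {z : FormalRep} (hz : z ∈ relations) :
    z ∈ linSector g :=
  ⟨0, by rw [mkQ_eq_zero_iff.mpr hz]; simp⟩

/-- A rational multiple of one generator lies in the sector. -/
theorem mem_linSector_single {g : ι → Q} {z : FormalRep} (i : ι) (q : ℚ)
    (h : mkQ z = ((q : ℚ) : K₀) • g i) : z ∈ linSector g := by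
  classical
  refine ⟨Pi.single i q, ?_⟩
  rw [h, Finset.sum_eq_single i (fun j _ hj => by simp [Pi.single_eq_of_ne hj]) (by simp)]
  simp

/-- `a • [z] = b • gᵢ` with `a ≠ 0` puts `z` in the sector. -/
theorem mem_linSector_of_nsmul_eq {g : ι → Q} {z : FormalRep} (i : ι) {a b : ℕ} (ha : a ≠ 0)
    (h : a • mkQ z = b • g i) : z ∈ linSector g := by
  refine mem_linSector_single i ((b : ℚ) / a) ?_
  have hz : mkQ z = (a : K₀)⁻¹ • (b • g i) := by
    rw [← h, ← Nat.cast_smul_eq_nsmul K₀ a, inv_smul_smul₀ (Nat.cast_ne_zero.mpr ha)]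
  rw [hz, ← Nat.cast_smul_eq_nsmul K₀ b, smul_smul]
  congr 1
  push_cast
  rw [div_eq_inv_mul]

/-- A representation KZ-equivalent to a member is a member. -/
theorem mem_linSector_of_equivalent {g : ι → Q} {n m : ℕ} {r : IntegralRep n}
    {r₀ : IntegralRep m} (h : Equivalent r r₀) (h₀ : of r₀ ∈ linSector g) :
    of r ∈ linSector g := by
  have h' : of r = of r₀ + (of r - of r₀) := by abel
  rw [h']
  exact add_mem h₀ (relations_le_linSector g h)

/-- Evaluation on a linear sector. -/
theorem eval_eq_of_mkQ_eq_sum {g : ι → Q} {z : FormalRep} {c : ι → ℚ}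
    (hc : mkQ z = ∑ i, ((c i : ℚ) : K₀) • g i) : eval z = ∑ i, (c i : ℝ) * evalQ (g i) := by
  rw [← evalQ_mkQ, hc, map_sum]
  refine Finset.sum_congr rfl fun i _ => ?_
  rw [evalQ_smul]
  push_cast
  rfl

/-- **Injectivity on a linear sector.**  If the values `evalQ gᵢ` are `ℚ`-linearly independent,
a member of `L(g)` with value `0` is a relation. -/
theorem linSector_kernel {g : ι → Q} (hg : LinearIndependent ℚ fun i => evalQ (g i))
    {z : FormalRep} (hz : z ∈ linSector g) (h0 : eval z = 0) : z ∈ relations := by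
  obtain ⟨c, hc⟩ := hz
  have hsum : ∑ i, c i • evalQ (g i) = 0 := by
    rw [← h0, eval_eq_of_mkQ_eq_sum hc]
    exact Finset.sum_congr rfl fun i _ => Rat.smul_def _ _
  have hc0 : ∀ i, c i = 0 := Fintype.linearIndependent_iff.mp hg c hsum
  rw [← mkQ_eq_zero_iff, hc]
  simp [hc0]

/-- **The Kontsevich–Zagier conjecture on a linear sector with independent values.** -/
theorem kz_linSector {g : ι → Q} (hg : LinearIndependent ℚ fun i => evalQ (g i)) {n m : ℕ}
    (r : IntegralRep n) (r' : IntegralRep m) (hr : of r ∈ linSector g)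
    (hr' : of r' ∈ linSector g) (hv : r.value = r'.value) : Equivalent r r' :=
  linSector_kernel hg (sub_mem hr hr') (by rw [map_sub, eval_of, eval_of, hv, sub_self])

/-! ## Lines through `1` -/

/-- `1, x` are `ℚ`-linearly independent when `x` is irrational. -/
theorem linearIndependent_one_of_irrational {x : ℝ} (hx : Irrational x) :
    LinearIndependent ℚ ![(1 : ℝ), x] := by
  rw [LinearIndependent.pair_iff]
  intro s t h
  rw [Rat.smul_def, Rat.smul_def, mul_one] at h
  by_cases ht : t = 0
  · subst ht
    simp only [Rat.cast_zero, zero_mul, add_zero, Rat.cast_eq_zero] at h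
    exact ⟨h, rfl⟩
  · exfalso
    refine hx ⟨-s / t, ?_⟩
    have ht' : (t : ℝ) ≠ 0 := by exact_mod_cast ht
    rw [Rat.cast_div, Rat.cast_neg, div_eq_iff ht']
    linarith

/-- The `ℚ`-line through `1` and `x`: classes `c₀ + c₁x`, `cᵢ ∈ ℚ`. -/
abbrev qLine (x : Q) : AddSubgroup FormalRep := linSector ![(1 : Q), x]

/-- **Injectivity on the line through an irrational class.** -/
theorem qLine_kernel {x : Q} (hx : Irrational (evalQ x)) {z : FormalRep} (hz : z ∈ qLine x)
    (h0 : eval z = 0) : z ∈ relations := by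
  refine linSector_kernel ?_ hz h0
  have h : (fun i => evalQ (![(1 : Q), x] i)) = ![(1 : ℝ), evalQ x] := by
    funext i
    fin_cases i
    · simp
    · simp
  rw [h]
  exact linearIndependent_one_of_irrational hx

/-- **The Kontsevich–Zagier conjecture on the line through an irrational class.** -/
theorem kz_qLine {x : Q} (hx : Irrational (evalQ x)) {n m : ℕ} (r : IntegralRep n)
    (r' : IntegralRep m) (hr : of r ∈ qLine x) (hr' : of r' ∈ qLine x)
    (hv : r.value = r'.value) : Equivalent r r' :=
  qLine_kernel hx (sub_mem hr hr') (by rw [map_sub, eval_of, eval_of, hv, sub_self])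

/-- A class equal to `q • x`, `q ∈ ℚ`, lies on the line. -/
theorem mem_qLine_of_mkQ_eq {x : Q} {z : FormalRep} (q : ℚ) (h : mkQ z = ((q : ℚ) : K₀) • x) :
    z ∈ qLine x :=
  mem_linSector_single 1 q h

/-- The rational constant cells `[K(q)]` lie on every line. -/
theorem constCell_mem_qLine (x : Q) (q : ℚ) :
    of (constCell (((q : ℚ) : K₀) : ℝ) (K₀.isAlgebraic _)) ∈ qLine x :=
  mem_linSector_single 0 q (by
    rw [← kappa_apply, ← algebraMap_eq_kappa, Algebra.algebraMap_eq_smul_one]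
    rfl)

/-! ## The `ζ(n)`-lines -/

variable {n : ℕ}

/-- The `ζ(n)`-line `L(1, [B_n])`. -/
abbrev zetaLine (n : ℕ) (hn : 2 ≤ n) : AddSubgroup FormalRep := qLine (mkQ (of (boxZetaRep n hn)))

/-- `evalQ [B_n] = ζ(n)`. -/
theorem evalQ_mkQ_boxZetaRep (hn : 2 ≤ n) : evalQ (mkQ (of (boxZetaRep n hn))) = zetaValue n := by
  rw [evalQ_mkQ, eval_of, boxZetaRep_value]

/-- The Kontsevich–Zagier conjecture restricted to the `ζ(n)`-line. -/
def KZOnZetaLine (n : ℕ) (hn : 2 ≤ n) : Prop :=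
  ∀ ⦃m m' : ℕ⦄ (r : IntegralRep m) (r' : IntegralRep m'),
    of r ∈ zetaLine n hn → of r' ∈ zetaLine n hn → r.value = r'.value → Equivalent r r'

/-- **`ζ(n) ∉ ℚ` ⟹ the Kontsevich–Zagier conjecture holds on the `ζ(n)`-line.** -/
theorem kz_zetaLine (hn : 2 ≤ n) (hirr : Irrational (zetaValue n)) : KZOnZetaLine n hn :=
  fun _ _ r r' hr hr' hv => kz_qLine (by rwa [evalQ_mkQ_boxZetaRep hn]) r r' hr hr' hv

/-- `B_n` lies on its line. -/
theorem boxZetaRep_mem_zetaLine (hn : 2 ≤ n) : of (boxZetaRep n hn) ∈ zetaLine n hn :=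
  mem_qLine_of_mkQ_eq 1 (by simp)

/-- The simplex `Λ_n` lies on the `ζ(n)`-line (`[B_n] = [Λ_n]`, `SoloBlindZetaBox`). -/
theorem simplexZetaRep_mem_zetaLine (hn : 2 ≤ n) : of (simplexZetaRep n hn) ∈ zetaLine n hn :=
  mem_linSector_of_equivalent (kz_zeta_box_simplex hn).symm
    (boxZetaRep_mem_zetaLine hn)

/-- The MZV simplex `Λ_(n)` lies on the `ζ(n)`-line. -/
theorem mzvSimplexRep_singleton_mem_zetaLine (hn : 2 ≤ n) :
    of (mzvSimplexRep [n] (isAdmissible_singleton hn)) ∈ zetaLine n hn :=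
  simplexZetaRep_mem_zetaLine hn

/-- The simplex `Λ_(2,1,…,1)` of `ζ(2,1,…,1) = ζ(k+2)` lies on the `ζ(k+2)`-line (duality,
`SoloBlindMZVDuality`). -/
theorem mzvSimplexRep_two_ones_mem_zetaLine (k : ℕ) :
    of (mzvSimplexRep (2 :: List.replicate k 1) (MZV.isAdmissible_add_two_cons_replicate_one 0 k))
      ∈ zetaLine (k + 2) (by omega) :=
  mem_linSector_of_equivalent (kz_box_zeta_two_ones k).symm
    (boxZetaRep_mem_zetaLine _)

/-- The box `B_(2,1,…,1)` of `ζ(2,1,…,1)` lies on the `ζ(k+2)`-line (`SoloBlindMZVBox`). -/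
theorem boxMZVRep_two_ones_mem_zetaLine (k : ℕ) :
    of (boxMZVRep (2 :: List.replicate k 1) (MZV.isAdmissible_add_two_cons_replicate_one 0 k))
      ∈ zetaLine (k + 2) (by omega) :=
  mem_linSector_of_equivalent (kz_mzv_box _ _) (mzvSimplexRep_two_ones_mem_zetaLine k)

/-- A sum of `k` copies of a member, e.g. `[B_n ⊔ ⋯ ⊔ B_n]`-type combinations, is a member. -/
theorem nsmul_mem_zetaLine (hn : 2 ≤ n) {z : FormalRep} (hz : z ∈ zetaLine n hn) (k : ℕ) :
    k • z ∈ zetaLine n hn :=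
  AddSubgroup.nsmul_mem _ hz k

/-! ## Instances: Apéry, Euler–Lindemann, Ball–Rivoal -/

/-- **Apéry ⟹ the Kontsevich–Zagier conjecture on the `ζ(3)`-line**: any two formal
combinations of representations whose classes are `ℚ`-combinations of `1` and `[B₃]` — e.g.
`B₃`, `Λ₃`, `Λ_(2,1)`, `B_(2,1)`, rational constants — with equal values are KZ-equivalent. -/
theorem kz_zetaLine_three : KZOnZetaLine 3 (by norm_num) :=
  kz_zetaLine _ Apery.irrational_zeta_three

/-- `ζ(n) > 0` for `n ≥ 2`. -/
theorem zetaValue_pos (hn : 1 < n) : 0 < zetaValue n :=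
  (Real.summable_one_div_nat_pow.mpr hn).tsum_pos (fun k => by positivity) 1 (by simp)

/-- **Euler**: `ζ(2k) = q·π^{2k}` with `q ∈ ℚ^×` (from the Literature Bernoulli formula). -/
theorem zetaValue_even_eq (k : ℕ) (hk : k ≠ 0) :
    ∃ q : ℚ, q ≠ 0 ∧ zetaValue (2 * k) = q * Real.pi ^ (2 * k) := by
  obtain ⟨q, hq⟩ := riemannZeta_two_mul_nat_mem_ratCast_mul_pi_pow hk
  have hz : ((zetaValue (2 * k) : ℝ) : ℂ) = ((q * Real.pi ^ (2 * k) : ℝ) : ℂ) := by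
    rw [ofReal_zetaValue (by omega)]
    push_cast
    exact hq
  have hre : zetaValue (2 * k) = q * Real.pi ^ (2 * k) := Complex.ofReal_injective hz
  refine ⟨q, ?_, hre⟩
  rintro rfl
  have h0 : zetaValue (2 * k) = 0 := by rw [hre, Rat.cast_zero, zero_mul]
  exact (zetaValue_pos (by omega)).ne' h0

/-- **Lindemann ⟹ `ζ(2k) ∉ ℚ`.** -/
theorem irrational_zetaValue_even (k : ℕ) (hk : k ≠ 0) : Irrational (zetaValue (2 * k)) := by
  obtain ⟨q, hq, h⟩ := zetaValue_even_eq k hk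
  rw [h]
  exact ((transcendental_pi_holds.pow (by omega)).irrational).ratCast_mul hq

/-- **The Kontsevich–Zagier conjecture on every `ζ(2k)`-line** (`k ≥ 1`). -/
theorem kz_zetaLine_even (k : ℕ) (hk : k ≠ 0) : KZOnZetaLine (2 * k) (by omega) :=
  kz_zetaLine _ (irrational_zetaValue_even k hk)

/-- `ζ(1)`, as the junk value of a divergent `tsum`, is `0`. -/
theorem zetaValue_one : zetaValue 1 = 0 := by
  unfold zetaValue
  simp only [pow_one]
  exact tsum_eq_zero_of_not_summable Real.not_summable_one_div_natCast

/-- **Ball–Rivoal ⟹ the Kontsevich–Zagier conjecture holds on infinitely many `ζ(2k+1)`-lines.** -/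
theorem infinite_setOf_kzOnZetaLine_odd :
    {k : ℕ | ∃ hk : 2 ≤ 2 * k + 1, KZOnZetaLine (2 * k + 1) hk}.Infinite := by
  refine infinite_setOf_irrational_zetaValue_odd_holds.mono fun k hk => ?_
  have hk0 : k ≠ 0 := by
    rintro rfl
    have h : Irrational (zetaValue 1) := by simpa using hk
    rw [zetaValue_one] at h
    exact h ⟨0, by simp⟩
  exact ⟨by omega, kz_zetaLine _ hk⟩

end SoloBlind

end Summit.KontsevichZagierPeriods.KontsevichZagierPeriods.Theorems
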